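import Mathlib.Data.Real.Basic
import Mathlib.Tactic.Linarith
import Mathlib.Tactic.Ring
import Mathlib.Tactic.Positivity
import HarnessLib

/-!
# QUANT lane R8, T-DEC, leg (III), blob case — the thin regime of `MixLawCellPDear`: the δ-BOUND `δ ≥ 1 − (3/2)λ` DERIVED EXACTLY
# (the second input of `thinC1'_of_bounds`, `…QuantGatedSliceMixLawThinC1`; the first is `thin_g_low`, `…ThinBounds`)

builds on p205010 (kernel theorem, internal audit signed; external expert review pending)

Support file (`--supports stmt-CriticalPhenomena-4575`), QUANT lane lead seat prim-quant-lead (gen 33), rung R8 of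
`run/shared/lean/prim/quant/LADDER.md`.  Memo: arm-2 g36 `…/prim-quant-arm-2-g36/THIN-REGIME-G36.md` §5 ('(δ-low) δ ≳ 1 − 3λ/2, TIGHT — derive the
exact bound'); lead g33 NOTES / HANDOFF GEN-33 closing note.  Pure real arithmetic, standard axioms, no sorries.

THE BOUND.  Notation: `d = k₂ − k₁`, `u = dλ` (so `S = c(k₁ + u)`, `c = 1 − z`), `α = agc`, `t = S + α`, `1 − δ = (t − 2k₁)/d`.  On the thin regime
B₂ > 0 (`(t−2k₁)(1−y) < y(k₂+a−t)`) together with top-affordability `y·k₂ ≤ S` gives the y-free consequence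
  [X]  `(t − 2k₁)·k₂ ≤ S·(k₂ + a − 2k₁)`   (`thin_X_of_B2_TA`),
and [X] together with `2(k₁+a) < t < k₁ + k₂`, `g ≤ 1`, `0 < c ≤ 1` gives
  [δ]  `2(t − 2k₁) ≤ 3λ(k₂ − k₁)`, i.e. `δ ≥ 1 − (3/2)λ`   (`thin_delta_low`; lead g33 exact census on the y-free region 122 636 / 0, worst
ratio 0.893; on the doubly-thin corner 0.876).  PROOF: with `F = k₁ + d`, `E = d + a − k₁`: (L1) `cu > 2k₁ + 2a − ck₁ − α` (from `2ℓ < t`);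
case `a ≤ 3k₁`: `α ≤ ac` and (L1) give `α − 2k₁ + ck₁ ≤ (3/2 − c)u` directly (the slack is `(k₁+a)(3 − (7/2)c) + 2ck₁ ≥ (3k₁ − a)/2`);
case `a > 3k₁`: [X] reads `(α − 2k₁)F ≤ c(k₁+u)(a − 2k₁)`, whence `cuE > R := 2aF − ck₁E`, and `R((3/2)F − cE) − c²k₁E² = F(3aF − cE(2a + (3/2)k₁)) ≥ 0`
by `d > 2a`, `a > 3k₁`; so `u((3/2)F − cE) ≥ ck₁E`, and adding [X] again gives `F(α − 2k₁ + ck₁) ≤ uF(3/2 − c)`.  No hypothesis on `y` survives.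

* `LawDec.thin_X_of_B2_TA` — [X] from B₂ > 0 and `y·k₂ ≤ S`.
* `LawDec.thin_delta_low` — [δ] from [X] and the frame.

[this work]; regime and plan: arm-2 g36.  Nothing here is cited as a published result.
-/

namespace Summit.CriticalPhenomena.PercolationContinuityZ3.Theorems

namespace Quant

namespace LawDec

/-- **[X] from B₂ > 0 and top-affordability**: `(t − 2k₁)(1 − y) < y(k₂ + a − t)`, `y·k₂ ≤ S`, `0 ≤ k₂ + a − 2k₁`
⟹ `(t − 2k₁)k₂ ≤ S(k₂ + a − 2k₁)`. [this work] -/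
theorem thin_X_of_B2_TA (y t S k₁ k₂ a : ℝ) (hB2 : (t - 2 * k₁) * (1 - y) < y * (k₂ + a - t))
    (hyk₂ : y * k₂ ≤ S) (hk₂0 : 0 ≤ k₂) (hw : 0 ≤ k₂ + a - 2 * k₁) :
    (t - 2 * k₁) * k₂ ≤ S * (k₂ + a - 2 * k₁) := by
  -- t − 2k₁ < y (k₂ + a − 2k₁), then multiply by k₂ and use y k₂ ≤ S
  have h1 : t - 2 * k₁ < y * (k₂ + a - 2 * k₁) := by nlinarith
  have h2 : (t - 2 * k₁) * k₂ ≤ y * (k₂ + a - 2 * k₁) * k₂ := mul_le_mul_of_nonneg_right h1.le hk₂0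
  have h3 : y * (k₂ + a - 2 * k₁) * k₂ = (y * k₂) * (k₂ + a - 2 * k₁) := by ring
  rw [h3] at h2
  exact le_trans h2 (mul_le_mul_of_nonneg_right hyk₂ hw)

set_option maxHeartbeats 400000 in
/-- **δ-low on the thin regime**: `0 < c ≤ 1`, `0 ≤ g ≤ 1`, `0 ≤ λ`, `0 ≤ k₁`, `0 < a`, `0 < d`, `S = c(k₁ + dλ)`, `t = S + agc`,
`2(k₁ + a) < t < k₁ + (k₁ + d)`, and [X] `(t − 2k₁)(k₁ + d) ≤ S(k₁ + d + a − 2k₁)` ⟹ `2(t − 2k₁) ≤ 3λd`. [this work] -/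
theorem thin_delta_low (c lam g k₁ a d S t : ℝ) (hc0 : 0 < c) (hc1 : c ≤ 1) (hlam0 : 0 ≤ lam)
    (hg0 : 0 ≤ g) (hg1 : g ≤ 1) (hk₁ : 0 ≤ k₁) (ha : 0 < a) (hd : 0 < d)
    (hS : S = c * (k₁ + d * lam)) (ht : t = S + a * g * c)
    (hllow : 2 * (k₁ + a) < t) (hcomp : t < k₁ + (k₁ + d))
    (hX : (t - 2 * k₁) * (k₁ + d) ≤ S * (k₁ + d + a - 2 * k₁)) :
    2 * (t - 2 * k₁) ≤ 3 * lam * d := by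
  set u : ℝ := d * lam with hu
  set α : ℝ := a * g * c with hα
  set F : ℝ := k₁ + d with hF
  set E : ℝ := d + a - k₁ with hE
  have hu0 : 0 ≤ u := mul_nonneg hd.le hlam0
  have hFpos : 0 < F := by rw [hF]; linarith
  have hd2a : 2 * a < d := by rw [ht, hS] at hcomp hllow; nlinarith
  have hp0 : 0 < t - 2 * k₁ := by linarith
  have hS0 : 0 ≤ S := by rw [hS]; exact mul_nonneg hc0.le (by linarith)
  have hEeq : F + a - 2 * k₁ = E := by rw [hF, hE]; ring
  have hEpos : 0 < E := by
    by_contra hcn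
    have hEle : E ≤ 0 := not_lt.1 hcn
    have h1 : S * (F + a - 2 * k₁) ≤ 0 := by rw [hEeq]; exact mul_nonpos_of_nonneg_of_nonpos hS0 hEle
    have h2 : 0 < (t - 2 * k₁) * F := mul_pos hp0 hFpos
    linarith
  have hαac : α ≤ a * c := by rw [hα]; nlinarith [mul_nonneg ha.le hc0.le]
  have hα0 : 0 ≤ α := by rw [hα]; exact mul_nonneg (mul_nonneg ha.le hg0) hc0.le
  -- (L1): c u > 2k₁ + 2a − c k₁ − α
  have hL1 : 2 * k₁ + 2 * a - c * k₁ - α < c * u := by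
    rw [ht, hS] at hllow; rw [hu, hα]; nlinarith
  -- the goal in (u, α) form
  suffices hgoal : α - 2 * k₁ + c * k₁ ≤ u * (3 / 2 - c) by
    have e : t - 2 * k₁ = α - 2 * k₁ + c * k₁ + c * u := by rw [ht, hS, hu, hα]; ring
    rw [e]; nlinarith
  by_cases hcase : a ≤ 3 * k₁
  · -- case a ≤ 3k₁: α ≤ ac and (L1)
    have h32 : 0 ≤ 3 / 2 - c := by linarith
    have h1 := mul_le_mul_of_nonneg_left hL1.le h32
    -- (3/2−c)(2k₁+2a−ck₁−α) ≤ (3/2−c)·c·u ; want c(α − 2k₁ + ck₁) ≤ c·u(3/2−c)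
    have hψ : c * (α - 2 * k₁ + c * k₁) ≤ (3 / 2 - c) * (2 * k₁ + 2 * a - c * k₁ - α) := by
      nlinarith [mul_nonneg hc0.le (sub_nonneg.2 hαac), mul_nonneg h32 (sub_nonneg.2 hαac), mul_nonneg hc0.le hk₁,
        mul_nonneg (sub_nonneg.2 hc1) (by linarith : (0:ℝ) ≤ k₁ + a)]
    have h2 : c * (α - 2 * k₁ + c * k₁) ≤ c * (u * (3 / 2 - c)) := by nlinarith
    exact le_of_mul_le_mul_left h2 hc0
  · -- case a > 3k₁
    have ha3 : 3 * k₁ < a := lt_of_not_ge hcase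
    -- [X] in (u, α) form: (α − 2k₁)F ≤ c(k₁+u)(a − 2k₁)
    have hX' : (α - 2 * k₁) * F ≤ c * (k₁ + u) * (a - 2 * k₁) := by
      have e1 : (t - 2 * k₁) * (k₁ + d) = (c * (k₁ + u) + (α - 2 * k₁)) * F := by rw [ht, hS, hu, hα, hF]; ring
      have e2 : S * (k₁ + d + a - 2 * k₁) = c * (k₁ + u) * F + c * (k₁ + u) * (a - 2 * k₁) := by rw [hS, hu, hF]; ring
      rw [e1, e2] at hX; nlinarith
    -- (**): c u E > R := 2aF − c k₁ E
    have h2 : 2 * a * F - c * k₁ * E < c * u * E := by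
      have h3 := mul_lt_mul_of_pos_right hL1 hFpos
      have e3 : c * u * E = c * u * F + c * u * (a - 2 * k₁) := by rw [hE, hF]; ring
      have e4 : 2 * a * F - c * k₁ * E = (2 * a - c * k₁) * F - c * k₁ * (a - 2 * k₁) := by rw [hE, hF]; ring
      rw [e3, e4]; nlinarith
    -- (***): R·((3/2)F − cE) ≥ c² k₁ E²
    have hbr : 0 < 3 / 2 * F - c * E := by
      rw [hF, hE]; nlinarith
    have hcore : 0 ≤ 3 * a * F - c * E * (2 * a + 3 / 2 * k₁) := by
      -- ⟸ 6aF ≥ E(4a + 3k₁) (c ≤ 1) ⟸ d(2a − 3k₁) + 7ak₁ − 4a² + 3k₁² ≥ 0 ⟸ (d − 2a)(2a − 3k₁) ≥ 0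
      have h4 : 0 ≤ (d - 2 * a) * (2 * a - 3 * k₁) := mul_nonneg (by linarith) (by linarith)
      have h5 : E * (4 * a + 3 * k₁) ≤ 6 * a * F := by rw [hE, hF]; nlinarith
      have h6 : c * E * (2 * a + 3 / 2 * k₁) ≤ E * (2 * a + 3 / 2 * k₁) := by
        have : 0 ≤ E * (2 * a + 3 / 2 * k₁) := mul_nonneg hEpos.le (by linarith)
        nlinarith
      linarith
    have h3 : c ^ 2 * k₁ * E ^ 2 ≤ (2 * a * F - c * k₁ * E) * (3 / 2 * F - c * E) := by
      have e5 : (2 * a * F - c * k₁ * E) * (3 / 2 * F - c * E) - c ^ 2 * k₁ * E ^ 2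
          = F * (3 * a * F - c * E * (2 * a + 3 / 2 * k₁)) := by ring
      nlinarith [mul_nonneg hFpos.le hcore]
    -- hence u((3/2)F − cE) ≥ c k₁ E
    have h4 : c * k₁ * E ≤ u * (3 / 2 * F - c * E) := by
      have h5 : (2 * a * F - c * k₁ * E) * (3 / 2 * F - c * E) ≤ c * u * E * (3 / 2 * F - c * E) :=
        mul_le_mul_of_nonneg_right h2.le hbr.le
      have h6 : c ^ 2 * k₁ * E ^ 2 ≤ c * u * E * (3 / 2 * F - c * E) := le_trans h3 h5
      -- divide by c E > 0
      have hcE : 0 < c * E := mul_pos hc0 hEpos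
      have e6 : c ^ 2 * k₁ * E ^ 2 = (c * E) * (c * k₁ * E) := by ring
      have e7 : c * u * E * (3 / 2 * F - c * E) = (c * E) * (u * (3 / 2 * F - c * E)) := by ring
      rw [e6, e7] at h6
      exact le_of_mul_le_mul_left h6 hcE
    -- combine with [X]
    have h7 : F * (α - 2 * k₁ + c * k₁) ≤ F * (u * (3 / 2 - c)) := by
      have e8 : F * (u * (3 / 2 - c)) = u * (3 / 2 * F - c * E) + c * u * (a - 2 * k₁) := by rw [hE, hF]; ring
      have e9 : F * (α - 2 * k₁ + c * k₁) = (α - 2 * k₁) * F + c * k₁ * F := by ring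
      have e10 : c * (k₁ + u) * (a - 2 * k₁) + c * k₁ * F = c * k₁ * E + c * u * (a - 2 * k₁) := by rw [hE, hF]; ring
      rw [e8, e9]; linarith
    exact le_of_mul_le_mul_left h7 hFpos

end LawDec

end Quant

end Summit.CriticalPhenomena.PercolationContinuityZ3.Theorems
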